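import Summits.Langlands.Langlands.Theses.SymmetryTypeSplit

/-!
# Route SymmetryTypeSplit — Assembly

The assembly item (stmt-Langlands-27290) of the child route `SymmetryTypeSplit` (decomp-langlands lens-2 gen 18; RESIDUAL MODE — the parent is the LIVE route SkinnerWilesDefectOne; a gate-native D-0170
refining child: `--refines route-Langlands-SkinnerWilesDefectOne:ReducibleOrdinaryProModular`, edge split, depth 1, no FRAME item) for the crux
`SkinnerWilesDefectOne.ReducibleOrdinaryProModular` (stmt-Langlands-12919):
`CMProModular → OddDescentProModular → GenericProModular → SkinnerWilesDefectOne.ReducibleOrdinaryProModular`.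

This is literally the type of the route file's sorry-free deciding theorem `Summit.Langlands.Langlands.Theses.SymmetryTypeSplit.closes`
(two excluded middles on the symmetry-type dials IsSelfTwist / IsOddDescent).  Nothing here proves `Langlands` (nor the parent crux): the assembly records only that the ledger items of the
route, taken together, imply the refined crux.
-/

set_option linter.dupNamespace false -- project-wide option (lakefile weak.linter.dupNamespace); `Summit.Langlands.Langlands` is the mandated namespace

namespace Summit.Langlands.Langlands.Theorems

/-- **Assembly of route SymmetryTypeSplit** (stmt-Langlands-27290): `E_cm → E_obc → E_gen → SkinnerWilesDefectOne.ReducibleOrdinaryProModular`.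
Proof: unfold `Assembly` and apply the route's deciding theorem `Theses.SymmetryTypeSplit.closes`. -/
theorem symmetryTypeSplit_assembly_proof :
    Summit.Langlands.Langlands.Theses.SymmetryTypeSplit.Assembly := by
  unfold Summit.Langlands.Langlands.Theses.SymmetryTypeSplit.Assembly
  exact Summit.Langlands.Langlands.Theses.SymmetryTypeSplit.closes

end Summit.Langlands.Langlands.Theorems
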